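import Summits.CriticalPhenomena.PercolationContinuityZ3.Theorems.PercNearOneGluingNoHeavyPcintNawRandMemKernel
import HarnessLib

/-!
# PCINT lane, reduced-state B2r certificates: lattice symmetries of `ℤ^d` from validated tables (any `d`)

Cell `prim-pcint` (PAPER-2 track (iii)), seat `prim-pcint-1` (gen 5); support file (`--supports stmt-CriticalPhenomena-4575`).
Does NOT build on p205010.  The kernel certificates of `…PcintNawRandMemKernelCert` refer to symmetries by number into a list
of TABLES `syms : List (List (ℕ × Bool))` (entry `i` = (source coordinate, keep-sign)), and need `syms c = NawK.spermKL (sym c)`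
for genuine signed permutations `sym c : SPerm d`.  For `d = 3` the instances use `sperm3` (`…PcintMemCertSym`); this file
serves every `d`: `NawK.validTab d gl` (a decidable validity test: `d` entries, sources `< d` and pairwise distinct),
`NawK.symOfTab d gl : SPerm d` (the signed permutation of a valid table, junk otherwise) and
`NawK.spermKL_symOfTab : validTab d gl = true → spermKL (symOfTab d gl) = gl`, whence `NawK.syms_spec_of_valid` for a
whole list checked by `decide`.
-/

namespace Summit.CriticalPhenomena.PercolationContinuityZ3.Theorems.Pcint

namespace NawK

variable {d : ℕ}

/-- Validity of a symmetry table: `d` entries, every source coordinate `< d`, sources pairwise distinct. [folklore] -/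
def validTab (d : ℕ) (gl : List (ℕ × Bool)) : Bool :=
  (gl.length == d) && gl.all (fun ks => decide (ks.1 < d)) && decide ((gl.map Prod.fst).Nodup)

/-- What validity says. [folklore] -/
theorem validTab_spec {gl : List (ℕ × Bool)} (h : validTab d gl = true) :
    gl.length = d ∧ (∀ ks ∈ gl, ks.1 < d) ∧ (gl.map Prod.fst).Nodup := by
  unfold validTab at h
  simp only [Bool.and_eq_true, beq_iff_eq, List.all_eq_true, decide_eq_true_eq] at h
  exact ⟨h.1.1, h.1.2, h.2⟩

/-- The coordinate map of a valid table. [folklore] -/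
def tabFun (gl : List (ℕ × Bool)) (h : validTab d gl = true) (i : Fin d) : Fin d :=
  ⟨(gl[i.1]'(by rw [(validTab_spec h).1]; exact i.2)).1,
    (validTab_spec h).2.1 _ (List.getElem_mem _)⟩

/-- The coordinate map of a valid table is injective. [folklore] -/
theorem tabFun_injective {gl : List (ℕ × Bool)} (h : validTab d gl = true) : Function.Injective (tabFun gl h) := by
  intro i j hij
  obtain ⟨hlen, -, hnd⟩ := validTab_spec h
  have hi : i.1 < (gl.map Prod.fst).length := by rw [List.length_map, hlen]; exact i.2
  have hj : j.1 < (gl.map Prod.fst).length := by rw [List.length_map, hlen]; exact j.2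
  have hval : (gl.map Prod.fst)[i.1] = (gl.map Prod.fst)[j.1] := by
    rw [List.getElem_map, List.getElem_map]
    exact congrArg Fin.val hij
  exact Fin.ext ((List.Nodup.getElem_inj_iff hnd).1 hval)

/-- **The signed permutation of a valid table** (junk: the identity, for invalid tables). [folklore] -/
noncomputable def symOfTab (d : ℕ) (gl : List (ℕ × Bool)) : SPerm d :=
  if h : validTab d gl = true then
    (Equiv.ofBijective (tabFun gl h) ((Finite.injective_iff_bijective).1 (tabFun_injective h)),
      fun i => (gl[i.1]'(by rw [(validTab_spec h).1]; exact i.2)).2)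
  else (Equiv.refl _, fun _ => true)

/-- **A valid table is the table of its signed permutation.** [folklore] -/
theorem spermKL_symOfTab {gl : List (ℕ × Bool)} (h : validTab d gl = true) : spermKL (symOfTab d gl) = gl := by
  obtain ⟨hlen, -, -⟩ := validTab_spec h
  unfold symOfTab spermKL
  rw [dif_pos h]
  apply List.ext_getElem (by rw [List.length_ofFn, hlen])
  intro i h1 h2
  rw [List.getElem_ofFn]
  simp only [Equiv.ofBijective_apply, tabFun]

/-- **A list of valid tables is a list of tables of signed permutations.** [folklore] -/
theorem syms_spec_of_valid {syms : List (List (ℕ × Bool))} (h : syms.all (validTab d) = true) :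
    ∀ c < syms.length, syms.getD c [] = spermKL (symOfTab d (syms.getD c [])) := by
  intro c hc
  rw [List.all_eq_true] at h
  have hmem : syms.getD c [] ∈ syms := by
    rw [List.getD_eq_getElem?_getD, List.getElem?_eq_getElem hc, Option.getD_some]
    exact List.getElem_mem hc
  exact (spermKL_symOfTab (h _ hmem)).symm

end NawK

end Summit.CriticalPhenomena.PercolationContinuityZ3.Theorems.Pcint
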